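/-
Copyright (c) 2026 the pub-hodgecm-mathlib formalisation cell (harness21).  Prover seat hodgecm-mathlib-K2Liu-p07 (g3), Track B «K2-LIT»,
#184♮ = hLiu418 = `stmt-HodgeConjecture-24832`; #42S payer road, organ S1 (local Siegel–Weil spanning), ROAD W letter (R-c) = (m1) frame step
(LEAD F0P6-plan (g14) BATCH #16 (2) «(R-c) = p07»; K2Liu-p01 (g8) 12:42:57Z «(R-c) FRAME STEP = p07»; referee K2Liu-ref1 (g5) AUDIT-AW2 R2, G3).
-/
import Literature.NumberTheory.Automorphic.TateLocalZetaShells       -- ★ `secondCountableTopology_localField` (local field bookkeeping)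
import Mathlib.MeasureTheory.Integral.Prod
import Mathlib.MeasureTheory.Group.Integral
import Mathlib.RingTheory.Valuation.Basic
import HarnessLib

/-!
# Crux `HLiu418`, #42S organ S1, ROAD W, letter (R-c): THE MIDDLE PROFILE OF THE LATTICE-PAIR WITNESS IS `vol · 1[Ψ trivial on one ball]` —
# orthogonality on the `u`-coordinate ball of the hyperbolic pair, in intrinsic `L_w`-coordinates

Cell `hodgecm-mathlib`, crux item hLiu418 = `stmt-HodgeConjecture-24832`; squad K2 ∕ K2Liu; LEAD F0P6-plan (g14), organ lead K2Liu-p06 (g4);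
prover K2Liu-p07 (g3).  THEOREMS ONLY (no `def`, no instance, no notation, no named-fact hypothesis, no `sorry`); lane
`--supports stmt-HodgeConjecture-24832 --as helper`.

WHY.  On the middle cell the local Siegel–Weil section of the organ's witness `ΓΦ_k = 1_{S₁²} − 1_{S₂²}` is (★ F6∕F6c + the Levi and unipotent letters)
`c · ∫ ψ_v(θ·(h′(y,y))) · 1_{γ(S₁∖S₂)}(y) dy` over the FLIPPED block `y = a·u + b·u′ + c·ℓ ∈ V′_w` (`(u,u′)` hyperbolic, `h′(ℓ,ℓ) = d`), i.e. — reading the phase as ONE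
continuous additive character `Ψ = ψ_v ∘ (θ·τ)` of `K = L_w` — the integral of `Ψ(a·σ(b) + d₀·c·σ(c))` (`d₀ = t₀·d`, `t₀ + σt₀ = 1`, K2Liu-p01 (g8)'s dyadic-safe letter) over the
PRODUCT set `{a ∈ B} × {b ∈ U} × {c ∈ C}` (`B = γ𝒪_K` a ball, `U = γ𝒪_Kˣ` a SHELL — on `S₁ ∖ S₂` the `u′`-coordinate is a unit —, `C = γ𝔭_K^k`).  Since the phase is
ADDITIVE in `a` (`h′(u,u) = 0`), orthogonality on the compact open subgroup `B` gives the shape below; the hypotheses are BY VALUE so that the inert (`K = L_{w₀}`,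
K2Liu-p01's letters `vK`, `σK`, boxes of ★ `K2LiuWitnessCellsInertReading`), split and ramified hands all instantiate it:
* `setIntegral_addSubgroup_addChar_mul` — `∫_{a ∈ B} Ψ(a·s) dμ = μ(B) · 1[Ψ(·s) trivial on B]` (translation invariance of the Haar measure);
* **`setIntegral_middleProfile_eq_ite`** — `∫_{((b,c),a) ∈ (U × C) × B} Ψ(a·σb + d₀·c·σc) = μ(B)·μ(U)·μ(C)·1[P]` whenever (unit condition) «`Ψ(·σb)` trivial on `B`» ⟺ `P`
  for every `b ∈ U` and (box condition, referee's G3 `t₀ d·N(𝔭^k) ⊆ Tr⁻¹(cond ψ)`) `P ⇒ Ψ(d₀ cσc) = 1` on `C`;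
* `forall_ball_mul_iff` — in valuation letters (`v ∘ σ = v`): «`Ψ(a·σb) = 1` for `v a ≤ ρ`» ⟺ «`Ψ z = 1` for `v z ≤ ρ·v b`» (`b ≠ 0`) — the unit condition holds on
  the shell `v b = ρ₂` with `P :=` «`Ψ` trivial on the ball of radius `ρ·ρ₂`»; `forall_ball_mul_unit_iff` — that `P` is invariant under `Ψ ↦ Ψ(u·)`, `v u = 1`.
CONSEQUENCES: two witnesses with the same `(u,u′)`-part (the inert `V′^±`, DESIGN-W3-v2 §0 (b)) have EQUAL middle profiles up to the volumes ⇒ K2Liu-p01 (g8)'s `λ`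
(`hf₀off`); the profile is invariant under `θ ↦ u·θ`, `u ∈ 𝒪_vˣ` ⇒ hypothesis (d) of ★ `K2LiuLocalSWRamifiedMiddleCell.middleCell_comp_eq` for the ramified
witness (`Ad(d_a)`: `c(x) ↦ a_v⁻¹c(x)`).  The `F_v`-box version is ★ `K2LiuLinearBlockOrthogonality`.
References: [WeilBNT1967] Ch. II §5 Prop. 12, Ch. VII §2 Prop. 2; [Weil1964] n° 13; [Kudla1994] §3; [KudlaSweet1997] §1; [Scharlau1985HermitianForms] Ch. 7 §6.
HONEST LABEL.  Count-neutral helper: `HC_CM` is proved only modulo the 7 printed citations (2 remaining named inputs: hLiu418 = `stmt-HodgeConjecture-24832`,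
h413 = `stmt-HodgeConjecture-24833`) until rung 0 closes.
-/

set_option autoImplicit false
set_option linter.dupNamespace false -- the mandated namespace repeats `HodgeConjecture.HodgeConjecture`

noncomputable section

open MeasureTheory Set
open scoped ENNReal
open Literature.NumberTheory.Automorphic

namespace Summit.HodgeConjecture.HodgeConjecture.Cruxes.HLiu418.K2LiuLatticePairMiddleProfile

variable {K : Type*} [Field K] [ValuativeRel K] [TopologicalSpace K] [IsNonarchimedeanLocalField K]
  [MeasurableSpace K] [BorelSpace K] (μ : Measure K) [μ.IsAddHaarMeasure]

/-! ## §1 Orthogonality on a compact open subgroup -/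

open scoped Classical in
/-- **`∫_{a ∈ B} Ψ(a·s) dμ(a) = μ(B) · 1[Ψ(·s) ≡ 1 on B]`** for an additive subgroup `B` of finite measure and a continuous additive character `Ψ`: if `Ψ(a₀ s) ≠ 1`
for some `a₀ ∈ B`, translating by `a₀` multiplies the integral by `Ψ(a₀ s)` (no continuity or finiteness needed: Bochner conventions). [cite: WeilBNT1967, Ch. II §5, Prop. 12] -/
theorem setIntegral_addSubgroup_addChar_mul (Ψ : AddChar K Circle) (B : AddSubgroup K) (hBm : MeasurableSet (B : Set K)) (s : K) :
    ∫ a in (B : Set K), ((Ψ (a * s) : Circle) : ℂ) ∂μ = if (∀ a ∈ B, Ψ (a * s) = 1) then (μ.real B : ℂ) else 0 := by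
  by_cases h : ∀ a ∈ B, Ψ (a * s) = 1
  · rw [if_pos h]
    have h1 : ∫ a in (B : Set K), ((Ψ (a * s) : Circle) : ℂ) ∂μ = ∫ a in (B : Set K), (1 : ℂ) ∂μ :=
      setIntegral_congr_fun hBm fun a ha => by rw [h a ha, Circle.coe_one]
    rw [h1, setIntegral_const, Complex.real_smul, mul_one]
  · rw [if_neg h]
    push Not at h
    obtain ⟨a₀, ha₀, hne⟩ := h
    set I := ∫ a in (B : Set K), ((Ψ (a * s) : Circle) : ℂ) ∂μ with hI
    -- translation by `a₀ ∈ B`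
    have h3 : ∀ a, (B : Set K).indicator (fun a => ((Ψ (a * s) : Circle) : ℂ)) (a₀ + a) =
        ((Ψ (a₀ * s) : Circle) : ℂ) * (B : Set K).indicator (fun a => ((Ψ (a * s) : Circle) : ℂ)) a := by
      intro a
      by_cases ha : a ∈ (B : Set K)
      · have ha' : a₀ + a ∈ (B : Set K) := B.add_mem ha₀ ha
        rw [indicator_of_mem ha', indicator_of_mem ha, add_mul, AddChar.map_add_eq_mul, Circle.coe_mul]
      · have ha' : a₀ + a ∉ (B : Set K) := fun h' => ha (by simpa using B.sub_mem h' ha₀)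
        rw [indicator_of_notMem ha', indicator_of_notMem ha, mul_zero]
    have hshift : I = ((Ψ (a₀ * s) : Circle) : ℂ) * I :=
      calc I = ∫ a, (B : Set K).indicator (fun a => ((Ψ (a * s) : Circle) : ℂ)) a ∂μ := (integral_indicator hBm).symm
        _ = ∫ a, (B : Set K).indicator (fun a => ((Ψ (a * s) : Circle) : ℂ)) (a₀ + a) ∂μ := (integral_add_left_eq_self _ a₀).symm
        _ = ∫ a, ((Ψ (a₀ * s) : Circle) : ℂ) * (B : Set K).indicator (fun a => ((Ψ (a * s) : Circle) : ℂ)) a ∂μ := by simp_rw [h3]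
        _ = ((Ψ (a₀ * s) : Circle) : ℂ) * I := by rw [integral_const_mul, hI, integral_indicator hBm]
    have hne' : ((Ψ (a₀ * s) : Circle) : ℂ) ≠ 1 := fun h' => hne (Subtype.ext (by simpa using h'))
    have : (1 - ((Ψ (a₀ * s) : Circle) : ℂ)) * I = 0 := by rw [sub_mul, one_mul, ← hshift, sub_self]
    rcases mul_eq_zero.1 this with h0 | h0
    · exact absurd (sub_eq_zero.1 h0).symm hne'
    · exact h0

/-! ## §2 The middle profile on a product `B × U × C` -/

open scoped Classical in
/-- **THE MIDDLE PROFILE IS `μ(B)·μ(U)·μ(C)·1[P]`.**  For a continuous additive character `Ψ` of `K`, a continuous additive `σ`, `d₀ ∈ K`, an additive subgroup `B`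
and sets `U`, `C` of finite measure: if for every `b ∈ U` «`Ψ(a·σ b) = 1` for all `a ∈ B`» is equivalent to one proposition `P` (UNIT condition: `b` ranges in a
shell), and `P` forces `Ψ(d₀·c·σ c) = 1` on `C` (BOX condition), then
`∫_{((b,c),a) ∈ (U × C) × B} Ψ(a·σ(b) + d₀·c·σ(c)) d((μ×μ)×μ) = μ(B)·μ(U)·μ(C)·1[P]`. [cite: WeilBNT1967, Ch. VII §2, Prop. 2] [cite: Kudla1994, §3] [cite: KudlaSweet1997, §1] -/
theorem setIntegral_middleProfile_eq_ite (Ψ : AddChar K Circle) (hΨ : Continuous Ψ) (σ : K →+ K) (hσ : Continuous σ) (d₀ : K)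
    (B : AddSubgroup K) (hBm : MeasurableSet (B : Set K)) (hBμ : μ B ≠ ∞)
    {U C : Set K} (hU : MeasurableSet U) (hUμ : μ U ≠ ∞) (hC : MeasurableSet C) (hCμ : μ C ≠ ∞)
    {P : Prop} (hunit : ∀ b ∈ U, ((∀ a ∈ B, Ψ (a * σ b) = 1) ↔ P)) (hbox : P → ∀ c ∈ C, Ψ (d₀ * c * σ c) = 1) :
    ∫ y in (U ×ˢ C) ×ˢ (B : Set K), ((Ψ (y.2 * σ y.1.1 + d₀ * y.1.2 * σ y.1.2) : Circle) : ℂ) ∂((μ.prod μ).prod μ) =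
      (μ.real B : ℂ) * (μ.real U : ℂ) * (μ.real C : ℂ) * (if P then 1 else 0) := by
  haveI : SecondCountableTopology K := secondCountableTopology_localField K
  -- continuity, integrability
  have hcont : Continuous fun y : (K × K) × K => ((Ψ (y.2 * σ y.1.1 + d₀ * y.1.2 * σ y.1.2) : Circle) : ℂ) := by
    refine continuous_subtype_val.comp (hΨ.comp ?_)
    exact (continuous_snd.mul (hσ.comp (continuous_fst.comp continuous_fst))).add
      ((continuous_const.mul (continuous_snd.comp continuous_fst)).mul (hσ.comp (continuous_snd.comp continuous_fst)))
  have hfin : ((μ.prod μ).prod μ) ((U ×ˢ C) ×ˢ (B : Set K)) ≠ ∞ := by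
    rw [Measure.prod_prod, Measure.prod_prod]
    exact ENNReal.mul_ne_top (ENNReal.mul_ne_top hUμ hCμ) hBμ
  have hint : IntegrableOn (fun y : (K × K) × K => ((Ψ (y.2 * σ y.1.1 + d₀ * y.1.2 * σ y.1.2) : Circle) : ℂ))
      ((U ×ˢ C) ×ˢ (B : Set K)) ((μ.prod μ).prod μ) :=
    Measure.integrableOn_of_bounded (M := 1) hfin hcont.aestronglyMeasurable (Filter.Eventually.of_forall fun y => by rw [Circle.norm_coe])
  rw [setIntegral_prod _ hint]
  -- the inner integral, for `(b, c) ∈ U × C`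
  have hinner : ∀ bc ∈ U ×ˢ C, ∫ a in (B : Set K), ((Ψ (a * σ bc.1 + d₀ * bc.2 * σ bc.2) : Circle) : ℂ) ∂μ =
      ((Ψ (d₀ * bc.2 * σ bc.2) : Circle) : ℂ) * (if P then (μ.real B : ℂ) else 0) := by
    rintro ⟨b, c⟩ hbc
    have h1 : ∀ a : K, ((Ψ (a * σ b + d₀ * c * σ c) : Circle) : ℂ) = ((Ψ (d₀ * c * σ c) : Circle) : ℂ) * ((Ψ (a * σ b) : Circle) : ℂ) := fun a => by
      rw [AddChar.map_add_eq_mul, Circle.coe_mul, mul_comm]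
    simp_rw [h1]
    rw [integral_const_mul, setIntegral_addSubgroup_addChar_mul μ Ψ B hBm (σ b)]
    congr 1
    by_cases hP : P
    · rw [if_pos hP, if_pos ((hunit b hbc.1).2 hP)]
    · rw [if_neg hP, if_neg (fun h' => hP ((hunit b hbc.1).1 h'))]
  rw [setIntegral_congr_fun (hU.prod hC) hinner]
  by_cases hP : P
  · simp only [if_pos hP, mul_one]
    have h2 : ∫ bc in U ×ˢ C, ((Ψ (d₀ * bc.2 * σ bc.2) : Circle) : ℂ) * (μ.real B : ℂ) ∂(μ.prod μ) = ∫ bc in U ×ˢ C, (μ.real B : ℂ) ∂(μ.prod μ) :=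
      setIntegral_congr_fun (hU.prod hC) fun bc hbc => by rw [hbox hP bc.2 hbc.2, Circle.coe_one, one_mul]
    rw [h2, setIntegral_const, Complex.real_smul, Measure.real, Measure.prod_prod, ENNReal.toReal_mul]
    push_cast
    simp only [Measure.real]
    ring
  · simp only [if_neg hP, mul_zero, integral_zero]

/-! ## §3 The unit and box conditions in valuation letters; dilation invariance -/

section Valuation

variable {Γ₀ : Type*} [LinearOrderedCommGroupWithZero Γ₀] (v : Valuation K Γ₀)

omit [ValuativeRel K] [TopologicalSpace K] [IsNonarchimedeanLocalField K] [MeasurableSpace K] [BorelSpace K] in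
/-- **THE UNIT CONDITION IN VALUATION LETTERS**: for `σ` preserving `v` and `b ≠ 0`, «`Ψ(a·σ b) = 1` whenever `v a ≤ ρ`» ⟺ «`Ψ z = 1` whenever `v z ≤ ρ · v b`» —
so on the shell `v b = ρ₂` the condition is the same proposition for every `b` (the `hunit` of `setIntegral_middleProfile_eq_ite` with the ball `B = {v ≤ ρ}`).
[cite: WeilBNT1967, Ch. II §5, Prop. 12] -/
theorem forall_ball_mul_iff (Ψ : AddChar K Circle) {σ : K →+* K} (hσv : ∀ x, v (σ x) = v x) (ρ : Γ₀) {b : K} (hb : b ≠ 0) :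
    (∀ a, v a ≤ ρ → Ψ (a * σ b) = 1) ↔ ∀ z, v z ≤ ρ * v b → Ψ z = 1 := by
  have hσb : σ b ≠ 0 := fun h => hb (by rw [← map_zero σ] at h; exact σ.injective h)
  have hvσb : v (σ b) ≠ 0 := (Valuation.ne_zero_iff v).2 hσb
  constructor
  · intro h z hz
    have hz' : v (z / σ b) ≤ ρ := by
      rw [map_div₀, div_le_iff₀ (zero_lt_iff.2 hvσb), hσv]
      exact hz
    have := h (z / σ b) hz'
    rwa [div_mul_cancel₀ z hσb] at this
  · intro h a ha
    refine h (a * σ b) ?_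
    rw [map_mul, hσv]
    gcongr

omit [ValuativeRel K] [TopologicalSpace K] [IsNonarchimedeanLocalField K] [MeasurableSpace K] [BorelSpace K] in
/-- **DILATION INVARIANCE**: for a unit `u` (`v u = 1`), «`Ψ(u·z) = 1` on the ball `v z ≤ r`» ⟺ «`Ψ z = 1` on the ball `v z ≤ r`» — the middle profile does not
change under `Ψ ↦ Ψ(u·)`, i.e. under `θ ↦ uθ` (ramified witness: `Ad(d_a)` with `a ∈ 𝒪_vˣ`). [cite: WeilBNT1967, Ch. II §5, Prop. 12] [cite: Kudla1994, §3] -/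
theorem forall_ball_mul_unit_iff (Ψ : AddChar K Circle) {u : K} (hu : v u = 1) (r : Γ₀) :
    (∀ z, v z ≤ r → Ψ (u * z) = 1) ↔ ∀ z, v z ≤ r → Ψ z = 1 := by
  have hu0 : u ≠ 0 := fun h => by rw [h, map_zero] at hu; exact zero_ne_one hu
  constructor
  · intro h z hz
    have := h (u⁻¹ * z) (by rw [map_mul, map_inv₀, hu, inv_one, one_mul]; exact hz)
    rwa [mul_inv_cancel_left₀ hu0] at this
  · intro h z hz
    exact h (u * z) (by rw [map_mul, hu, one_mul]; exact hz)

omit [ValuativeRel K] [TopologicalSpace K] [IsNonarchimedeanLocalField K] [MeasurableSpace K] [BorelSpace K] in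
/-- **THE BOX CONDITION IN VALUATION LETTERS**: if `Ψ` is trivial on the ball `v z ≤ R` and `v (d₀ · c · σ c) ≤ R` for all `c` in the `c`-box (referee's G3
`t₀ d · N(𝔭^k) ⊆` that ball, `k ≥ k₀(v)`), then `Ψ(d₀·c·σ c) = 1` on the box — the `hbox` of `setIntegral_middleProfile_eq_ite`. [cite: Kudla1994, §3] -/
theorem box_condition (Ψ : AddChar K Circle) (σ : K →+* K) (d₀ : K) (R : Γ₀) {C : Set K} (hC : ∀ c ∈ C, v (d₀ * c * σ c) ≤ R)
    (hP : ∀ z, v z ≤ R → Ψ z = 1) : ∀ c ∈ C, Ψ (d₀ * c * σ c) = 1 :=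
  fun c hc => hP _ (hC c hc)

end Valuation

end Summit.HodgeConjecture.HodgeConjecture.Cruxes.HLiu418.K2LiuLatticePairMiddleProfile
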